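import Summits.CriticalPhenomena.PercolationContinuityZ3.Theorems.Transplant.FKConnectivityAllQForestAdjacentNoSqArrow
import Summits.CriticalPhenomena.PercolationContinuityZ3.Theorems.Transplant.FKConnectivityAllQForestSquareCex
import HarnessLib

/-!
# The adjacent forest Rayleigh nodes are HEREDITARY along injections of vertex types; hence the square-strengthened node fails on
# `Fin n` for EVERY `n ≥ 10`, and the square-free node descends from larger to smaller vertex types

Support file (`--supports stmt-CriticalPhenomena-4575`), FK sub-lane `prim-bschramm-fk-1` (gen 17) of the post-continuity programme;
builds on p205010 (kernel theorem, internal audit signed; external expert review pending).  No definitions, no named facts, no sorries;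
standard axioms.

With gen 17's transport of fibre counts (`fibreCount_image`, `isForestCfg_image_iff`; fk-3 g8's `reachable_image_iff`): a fibre of `V`
is a fibre of `U ⊇ j(V)` with the same three counts, so **`adjForestRayleighOn_of_embedding`** / **`adjForestRayleighNoSqOn_of_embedding`**
(`AdjForestRayleigh(NoSq)On U → AdjForestRayleigh(NoSq)On V` for `j : V ↪ U`).  Consequences: **`not_adjForestRayleighOn_fin`** — the
square-strengthened (♣) (p309135) fails on `Fin n` for every `n ≥ 10` (gen 17's `not_adjForestRayleighOn_fin_ten` moved up along
`Fin.castLEEmb`); `adjForestRayleighNoSqOn_fin_mono` — the square-free node on `Fin n` implies it on every `Fin k`, `k ≤ n`.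
[cite: CibulkaHladkyLaCroixWagner2008, Thm. 1 (p. 2)] [cite: SempleWelsh2008, Conj. 1.1 (p. 2)] [cite: Linusson2011, Prop. 2.6]
-/

noncomputable section

namespace Summit.CriticalPhenomena.PercolationContinuityZ3.Theorems

namespace FK

open MeasureTheory Set Literature.Probability.LatticeModels Literature.Probability.Percolation
open scoped Classical symmDiff

section Embedding

variable {V U : Type*} [Fintype V] [Fintype U]

/-- Pullback of the forest event. [cite: Grimmett2006, §1.5 (p. 13)] -/
theorem image_mem_forestEv_iff (j : V ↪ U) (ω : BondConfig V) : Sym2.map j '' ω ∈ forestEv U ↔ ω ∈ forestEv V :=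
  isForestCfg_image_iff j ω

omit [Fintype V] [Fintype U] in
/-- Pullback of a pinned pair. [folklore] -/
theorem mk_mem_image_iff (j : V ↪ U) (ω : BondConfig V) (a b : V) : s(j a, j b) ∈ Sym2.map j '' ω ↔ s(a, b) ∈ ω := by
  rw [← Sym2.map_mk, map_mem_image_iff]

omit [Fintype V] [Fintype U] in
/-- Images of `ω ∖ {e}`. [folklore] -/
theorem image_sdiff_singleton (j : V ↪ U) (ω : BondConfig V) (e : Sym2 V) :
    Sym2.map j '' ω \ {Sym2.map j e} = Sym2.map j '' (ω \ {e}) := by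
  rw [Set.image_sdiff (Sym2.map.injective j.injective), Set.image_singleton]

/-- Pullback of CHLW's `𝒳⁻`. [cite: CibulkaHladkyLaCroixWagner2008, Thm. 1 (p. 2)] -/
theorem image_mem_xMinusEv_iff (j : V ↪ U) (ω : BondConfig V) (o v y : V) :
    Sym2.map j '' ω ∈ xMinusEv (j o) (j v) (j y) ↔ ω ∈ xMinusEv o v y := by
  unfold xMinusEv
  rw [mem_setOf_eq, mem_setOf_eq, isForestCfg_image_iff, reachable_image_iff, reachable_image_iff, reachable_image_iff]

/-- Pullback of the square set `{e ∈ ω, ω ∖ {e} ∈ 𝒳⁻}`. [cite: CibulkaHladkyLaCroixWagner2008, Thm. 1 (p. 2)] -/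
theorem image_mem_sqSet_iff (j : V ↪ U) (ω : BondConfig V) (a b o v y : V) :
    Sym2.map j '' ω ∈ {ω' : BondConfig U | s(j a, j b) ∈ ω' ∧ ω' \ {s(j a, j b)} ∈ xMinusEv (j o) (j v) (j y)} ↔
      ω ∈ {ω' : BondConfig V | s(a, b) ∈ ω' ∧ ω' \ {s(a, b)} ∈ xMinusEv o v y} := by
  rw [mem_setOf_eq, mem_setOf_eq, mk_mem_image_iff, ← Sym2.map_mk, image_sdiff_singleton, image_mem_xMinusEv_iff]

/-- **The square-strengthened node is hereditary**: `AdjForestRayleighOn U → AdjForestRayleighOn V` along `j : V ↪ U`.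
[cite: CibulkaHladkyLaCroixWagner2008, Thm. 1 (p. 2)] -/
theorem adjForestRayleighOn_of_embedding (j : V ↪ U) (h : AdjForestRayleighOn U) : AdjForestRayleighOn V := by
  intro M u₀ hd o v y hvy
  have hdj : Disjoint (Sym2.map j '' u₀) (Sym2.map j '' M) := (Set.disjoint_image_iff (Sym2.map.injective j.injective)).2 hd
  have key := h (Sym2.map j '' M) (Sym2.map j '' u₀) hdj (j o) (j v) (j y) (fun h' => hvy (j.injective h'))
  rw [fibreCount_image j M u₀ (A := forestEv V ∩ {ω | s(o, v) ∈ ω ∧ s(o, y) ∈ ω}) (B := forestEv V)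
      (fun ω => by rw [mem_inter_iff, mem_inter_iff, image_mem_forestEv_iff, mem_setOf_eq, mem_setOf_eq, mk_mem_image_iff,
        mk_mem_image_iff]) (image_mem_forestEv_iff j),
    fibreCount_image j M u₀ (A := {ω | s(o, v) ∈ ω ∧ ω \ {s(o, v)} ∈ xMinusEv o v y})
      (B := {ω | s(o, y) ∈ ω ∧ ω \ {s(o, y)} ∈ xMinusEv o v y}) (image_mem_sqSet_iff j · o v o v y)
      (image_mem_sqSet_iff j · o y o v y),
    fibreCount_image j M u₀ (A := forestEv V ∩ {ω | s(o, v) ∈ ω}) (B := forestEv V ∩ {ω | s(o, y) ∈ ω})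
      (fun ω => by rw [mem_inter_iff, mem_inter_iff, image_mem_forestEv_iff, mem_setOf_eq, mem_setOf_eq, mk_mem_image_iff])
      (fun ω => by rw [mem_inter_iff, mem_inter_iff, image_mem_forestEv_iff, mem_setOf_eq, mem_setOf_eq, mk_mem_image_iff])] at key
  exact key

/-- **The square-free node is hereditary**: `AdjForestRayleighNoSqOn U → AdjForestRayleighNoSqOn V` along `j : V ↪ U`.
[cite: SempleWelsh2008, Conj. 1.1 (p. 2)] -/
theorem adjForestRayleighNoSqOn_of_embedding (j : V ↪ U) (h : AdjForestRayleighNoSqOn U) : AdjForestRayleighNoSqOn V := by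
  intro M u₀ hd o v y hvy
  have hdj : Disjoint (Sym2.map j '' u₀) (Sym2.map j '' M) := (Set.disjoint_image_iff (Sym2.map.injective j.injective)).2 hd
  have key := h (Sym2.map j '' M) (Sym2.map j '' u₀) hdj (j o) (j v) (j y) (fun h' => hvy (j.injective h'))
  rw [fibreCount_image j M u₀ (A := forestEv V ∩ {ω | s(o, v) ∈ ω ∧ s(o, y) ∈ ω}) (B := forestEv V)
      (fun ω => by rw [mem_inter_iff, mem_inter_iff, image_mem_forestEv_iff, mem_setOf_eq, mem_setOf_eq, mk_mem_image_iff,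
        mk_mem_image_iff]) (image_mem_forestEv_iff j),
    fibreCount_image j M u₀ (A := forestEv V ∩ {ω | s(o, v) ∈ ω}) (B := forestEv V ∩ {ω | s(o, y) ∈ ω})
      (fun ω => by rw [mem_inter_iff, mem_inter_iff, image_mem_forestEv_iff, mem_setOf_eq, mem_setOf_eq, mk_mem_image_iff])
      (fun ω => by rw [mem_inter_iff, mem_inter_iff, image_mem_forestEv_iff, mem_setOf_eq, mem_setOf_eq, mk_mem_image_iff])] at key
  exact key

end Embedding

/-- **`¬ AdjForestRayleighOn (Fin n)` for every `n ≥ 10`.** [cite: CibulkaHladkyLaCroixWagner2008, Thm. 1 (p. 2)] -/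
theorem not_adjForestRayleighOn_fin {n : ℕ} (hn : 10 ≤ n) : ¬ AdjForestRayleighOn (Fin n) := fun h =>
  ForestSquareCex.not_adjForestRayleighOn_fin_ten (adjForestRayleighOn_of_embedding (Fin.castLEEmb hn) h)

/-- **Monotonicity of the square-free node in the vertex type**: from `Fin n` down to `Fin k`, `k ≤ n`. [cite: SempleWelsh2008, Conj. 1.1 (p. 2)] -/
theorem adjForestRayleighNoSqOn_fin_mono {k n : ℕ} (hkn : k ≤ n) (h : AdjForestRayleighNoSqOn (Fin n)) : AdjForestRayleighNoSqOn (Fin k) :=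
  adjForestRayleighNoSqOn_of_embedding (Fin.castLEEmb hkn) h

end FK

end Summit.CriticalPhenomena.PercolationContinuityZ3.Theorems

end
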